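import Literature.Analysis.FluidPDE.TaoCascadeScaleOneClose
import Literature.Analysis.FluidPDE.TaoCascadeZeroScaleSetup
import HarnessLib

/-!
# Tao's cascade ODE, proof of Prop. 6.5 — Prop. 6.13, IV: the bounds in the parameter regime

T. Tao, *Finite time blowup for an averaged three-dimensional Navier–Stokes equation*,
J. Amer. Math. Soc. 29 (2016), 601–674 (arXiv:1402.0290v3), §6.6 Prop. 6.13 (6.89)–(6.92): "for all
`0 ≤ t ≤ τ`: `|b₁(t)| ≲ K^{-1/4}ε`, `|c₁(t)| ≲ K^{-1/4}exp(-K^{10}/2)ε²`, `c₁(t) ≥ -O((1+ε₀)^{-n₀/3})`,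
`|d₁(t)| ≲ K^{-20}`", whenever `0 ≤ τ ≤ T₁` and (6.86) `∫₀^τ a₁² ≤ K^{-1/4}`.

`prop613_bounds` (`TaoCascadeScaleOneClose.lean`) gives these bounds with abstract source levels
`S₀, S₁, B` and an explicit closing condition. Here the levels are instantiated
(`S₀ = 2ε²e^{-K^{10}}K^{-1/4}`, `S₁ = 9ε²e^{-K^{10}}K^{-1/4}`, `B = 11εK^{-1/4}`, `P = K^{-1/4}`) and the
closing condition is verified under five explicit largeness/smallness inequalities on the
parameters — each of the form "`K` large depending on `ε₀, C₃`", "`n₀` large depending on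
`ε₀, K, ε, C₁, C₃`" (the hypotheses `hKa, hKc, hKd, hδ1, hδ2` below; no condition couples `ε` to `K`
other than `ε ≤ 1`). The result is **Prop. 6.13 in closed form** over `RescaledHypotheses γ …`:
on a present interval `[0, T]`, `T ≤ 100`, with `Ẽ₁ ≤ 1`, `Ẽ₂ ≤ K^{-30}` and `∫₀ᵀ a₁² ≤ K^{-1/4}`,

  `|b₁| ≤ 11 K^{-1/4} ε`, `|c₁| ≤ 9 K^{-1/4} e^{-(94/100)K^{10}} ε²`,
  `c₁ ≥ -e^{(6/100)K^{10}} 4C₁(1+ε₀)^{-n₀/2}(Ξ C₃ G_{496} + 100)`, `|d₁| ≤ (√2K^{-15} + …) e^{3600√2K^{-14}}`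

(`prop613_regime`), together with the two forms consumed downstream: the forwards-exit exclusion
`|d₁| < ½K^{-10}` of Cor. 6.14 (`TaoCascadeSecondBootstrap.lean`, hypothesis `h13d`;
`prop613_d_one_lt`) and the predicate `ZeroScale.SmallModes K ε 11` of
`TaoCascadeZeroScaleSetup.lean` (`prop613_smallModes`).

## References

* T. Tao, arXiv:1402.0290v3, §6.6 Prop. 6.13 (6.86), (6.89)–(6.92). [`Tao2016AveragedNS`]
-/

noncomputable section

open Set MeasureTheory intervalIntegral Filter Topology
open Literature.Analysis.ODE

namespace Literature.Analysis.FluidPDE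

namespace TaoCascade

section Regime

variable {γ ε₀ K ε C₁ C₂ C₃ : ℝ} {n₀ N : ℤ} {τ : ℤ → ℝ} {Xr : Fin 4 → ℤ → ℝ → ℝ} {Er : ℤ → ℝ → ℝ}

/-- `e^{(6/100)K^{10}} e^{-K^{10}} = e^{-(94/100)K^{10}}`. [folklore] -/
theorem exp_six_mul_exp_neg (K : ℝ) :
    Real.exp (6 / 100 * K ^ 10) * Real.exp (-K ^ 10) = Real.exp (-(94 / 100) * K ^ 10) := by
  rw [← Real.exp_add]; congr 1; ring

/-- `(e^{(6/100)K^{10}} · c ε² e^{-K^{10}} x)² = c² ε⁴ x² e^{-(188/100)K^{10}}`. [folklore] -/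
theorem sq_level_eq (K c ε x : ℝ) :
    (Real.exp (6 / 100 * K ^ 10) * (c * ε ^ 2 * Real.exp (-K ^ 10) * x)) ^ 2 =
      c ^ 2 * ε ^ 4 * x ^ 2 * Real.exp (-(188 / 100) * K ^ 10) := by
  have h : Real.exp (-(188 / 100) * K ^ 10) = (Real.exp (6 / 100 * K ^ 10) * Real.exp (-K ^ 10)) ^ 2 := by
    rw [exp_six_mul_exp_neg, ← Real.exp_nat_mul]; congr 1; push_cast; ring
  rw [h]; ring

/-- **Prop. 6.13 in the parameter regime.** Let `h : RescaledHypotheses γ …` with `0 < ε₀ < 1`,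
`K ≥ 1`, `0 < ε ≤ 1`, `C₁, C₃ ≥ 0`, `n₀ ≤ N`, and write `x = K^{-1/4}`, `δ = (1+ε₀)^{-n₀/2}`,
`Ξ = e·6√2K·cumEnergyConst ε₀ C₃`, `G_s = geomConst ε₀ s`. Assume the improved-decay condition `hκ`
and: (`hKa`) `12K^{-30}C₃G_{747} ≤ x`; (`hKc`) `48600 K^{10}e^{-(188/100)K^{10}} x (C₃G_{741}+1) ≤ 1`;
(`hKd`) `x(3C₃G_{245} + 1100) < 1/100`; (`hδ1`) `4C₁δ Ξ C₃ G_{496} ≤ ε²e^{-K^{10}}x`;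
(`hδ2`) `400C₁δ ≤ ε²e^{-K^{10}}x`. Then on every present interval `[0, T]`, `T ≤ 100`, on which
`Ẽ₁ ≤ 1`, `Ẽ₂ ≤ K^{-30}` and `∫₀ᵀ a₁² ≤ x` ((6.86)), for all `t ∈ [0, T]`:
`|b₁(t)| ≤ 11xε`, `|c₁(t)| ≤ 9x e^{-(94/100)K^{10}} ε²`,
`c₁(t) ≥ -e^{(6/100)K^{10}}4C₁δ(ΞC₃G_{496} + 100)`,
`|d₁(t)| ≤ (√2K^{-15} + 100(6√2·9x e^{-(94/100)K^{10}} + 4C₁δ)) e^{3600√2K^{-14}}`.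
[cite: Tao2016AveragedNS, §6.6 Prop. 6.13 (6.89)–(6.92)] -/
theorem RescaledHypotheses.prop613_regime
    (h : RescaledHypotheses γ ε₀ K ε C₁ C₂ C₃ n₀ N τ Xr Er) (hε₀ : 0 < ε₀) (hε₀1 : ε₀ < 1)
    (hK : 1 ≤ K) (hε : 0 < ε) (hε1 : ε ≤ 1) (hC₁ : 0 ≤ C₁) (hC₃ : 0 ≤ C₃) (hN : n₀ ≤ N)
    (hκ : 36 * Real.sqrt 2 * K * ((K ^ 15)⁻¹ * (1 + ε₀) ^ (-(999 : ℝ) / 100) * C₃ *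
      geomConst ε₀ ((248 : ℝ) / 100)) ≤ 1)
    (hKa : 12 * ((K ^ 30)⁻¹ * C₃ * geomConst ε₀ ((747 : ℝ) / 100)) ≤ K ^ (-(1 : ℝ) / 4))
    (hKc : 48600 * K ^ 10 * Real.exp (-(188 / 100) * K ^ 10) * K ^ (-(1 : ℝ) / 4) *
      (C₃ * geomConst ε₀ ((741 : ℝ) / 100) + 1) ≤ 1)
    (hKd : K ^ (-(1 : ℝ) / 4) * (3 * C₃ * geomConst ε₀ ((245 : ℝ) / 100) + 1100) < 1 / 100)
    (hδ1 : 4 * C₁ * (1 + ε₀) ^ (-(n₀ : ℝ) / 2) *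
      (Real.exp 1 * (6 * Real.sqrt 2 * K) * cumEnergyConst ε₀ C₃ * C₃ * geomConst ε₀ ((496 : ℝ) / 100)) ≤
      ε ^ 2 * Real.exp (-K ^ 10) * K ^ (-(1 : ℝ) / 4))
    (hδ2 : 400 * C₁ * (1 + ε₀) ^ (-(n₀ : ℝ) / 2) ≤ ε ^ 2 * Real.exp (-K ^ 10) * K ^ (-(1 : ℝ) / 4))
    {T : ℝ} (hT0 : 0 ≤ T) (hT : T ≤ 100) (hE1 : ∀ t ∈ Icc 0 T, Er 1 t ≤ 1)
    (hE2 : ∀ t ∈ Icc 0 T, Er 2 t ≤ (K ^ 30)⁻¹)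
    (hP : ∫ s in (0 : ℝ)..T, Xr 0 1 s ^ 2 ≤ K ^ (-(1 : ℝ) / 4)) {t : ℝ} (ht : t ∈ Icc 0 T) :
    |Xr 1 1 t| ≤ 11 * K ^ (-(1 : ℝ) / 4) * ε ∧
    |Xr 2 1 t| ≤ 9 * K ^ (-(1 : ℝ) / 4) * Real.exp (-(94 / 100) * K ^ 10) * ε ^ 2 ∧
    -(Real.exp (6 / 100 * K ^ 10) * (4 * C₁ * (1 + ε₀) ^ (-(n₀ : ℝ) / 2) *
      (Real.exp 1 * (6 * Real.sqrt 2 * K) * cumEnergyConst ε₀ C₃ * C₃ * geomConst ε₀ ((496 : ℝ) / 100) +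
        100))) ≤ Xr 2 1 t ∧
    |Xr 3 1 t| ≤ (Real.sqrt 2 * (K ^ 15)⁻¹ +
      100 * (6 * Real.sqrt 2 * (ε ^ 2)⁻¹ *
        (9 * K ^ (-(1 : ℝ) / 4) * Real.exp (-(94 / 100) * K ^ 10) * ε ^ 2) +
        4 * C₁ * (1 + ε₀) ^ (-(n₀ : ℝ) / 2))) * Real.exp (3600 * Real.sqrt 2 * (K ^ 14)⁻¹) := by
  -- abbreviations
  obtain ⟨x, hx⟩ : ∃ x : ℝ, x = K ^ (-(1 : ℝ) / 4) := ⟨_, rfl⟩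
  obtain ⟨E, hEdef⟩ : ∃ E : ℝ, E = Real.exp (-K ^ 10) := ⟨_, rfl⟩
  obtain ⟨δ, hδdef⟩ : ∃ δ : ℝ, δ = (1 + ε₀) ^ (-(n₀ : ℝ) / 2) := ⟨_, rfl⟩
  obtain ⟨A, hAdef⟩ : ∃ A : ℝ, A = (K ^ 30)⁻¹ * C₃ * geomConst ε₀ ((747 : ℝ) / 100) := ⟨_, rfl⟩
  obtain ⟨Bx, hBxdef⟩ : ∃ Bx : ℝ, Bx = Real.exp 1 * (6 * Real.sqrt 2 * K) * cumEnergyConst ε₀ C₃ * C₃ *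
      geomConst ε₀ ((496 : ℝ) / 100) := ⟨_, rfl⟩
  obtain ⟨G741, hG741def⟩ : ∃ G : ℝ, G = C₃ * geomConst ε₀ ((741 : ℝ) / 100) := ⟨_, rfl⟩
  obtain ⟨G245, hG245def⟩ : ∃ G : ℝ, G = C₃ * geomConst ε₀ ((245 : ℝ) / 100) := ⟨_, rfl⟩
  obtain ⟨W, hWdef⟩ : ∃ W : ℝ, W = K ^ 10 * Real.exp (-(188 / 100) * K ^ 10) := ⟨_, rfl⟩
  rw [← hx] at hKa hKc hKd hδ1 hδ2 hP ⊢
  rw [← hEdef] at hδ1 hδ2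
  rw [← hδdef] at hδ1 hδ2 ⊢
  rw [← hAdef] at hKa
  rw [← hBxdef] at hδ1 ⊢
  have hKpos : 0 < K := by linarith only [hK]
  have h0 : (0 : ℝ) < 1 + ε₀ := by linarith only [hε₀]
  have hxpos : 0 < x := by rw [hx]; exact Real.rpow_pos_of_pos hKpos _
  have hxle1 : x ≤ 1 := by rw [hx]; exact Real.rpow_le_one_of_one_le_of_nonpos hK (by norm_num)
  have hEpos : 0 < E := by rw [hEdef]; exact Real.exp_pos _
  have hK10 : 0 ≤ K ^ 10 := by positivity
  have hEle1 : E ≤ 1 := by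
    rw [hEdef, Real.exp_le_one_iff]
    linarith only [hK10]
  have hδpos : 0 < δ := by rw [hδdef]; exact Real.rpow_pos_of_pos h0 _
  have hA0 : 0 ≤ A := by
    rw [hAdef]; have := geomConst_pos hε₀ (s := (747 : ℝ) / 100) (by norm_num); positivity
  have hBx0 : 0 ≤ Bx := by
    rw [hBxdef]
    have := geomConst_pos hε₀ (s := (496 : ℝ) / 100) (by norm_num)
    have := cumEnergyConst_nonneg hε₀ hC₃
    positivity
  have hG7410 : 0 ≤ G741 := by
    rw [hG741def]; have := geomConst_pos hε₀ (s := (741 : ℝ) / 100) (by norm_num); positivity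
  have hG2450 : 0 ≤ G245 := by
    rw [hG245def]; have := geomConst_pos hε₀ (s := (245 : ℝ) / 100) (by norm_num); positivity
  have hW0 : 0 ≤ W := by rw [hWdef]; positivity
  have hε2 : ε ^ 2 ≤ 1 := by nlinarith only [hε, hε1]
  have hεE : ε * E ≤ 1 := by nlinarith only [hε, hε1, hEpos, hEle1]
  have hεx0 : 0 ≤ ε * x := by positivity
  have hε2Ex : ε ^ 2 * E * x ≤ ε * x := by
    calc ε ^ 2 * E * x = (ε * E) * (ε * x) := by ring
      _ ≤ 1 * (ε * x) := mul_le_mul_of_nonneg_right hεE hεx0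
      _ = ε * x := one_mul _
  -- `hKc` rewritten in terms of `W`
  have hKc' : 48600 * (W * x * (G741 + 1)) ≤ 1 := by
    rw [hWdef, hG741def]
    calc _ = 48600 * K ^ 10 * Real.exp (-(188 / 100) * K ^ 10) * x *
        (C₃ * geomConst ε₀ ((741 : ℝ) / 100) + 1) := by ring
      _ ≤ 1 := hKc
  have hWx1 : 48600 * (W * x) ≤ 1 := by
    have e1 : W * x ≤ W * x * (G741 + 1) := by
      have : (1 : ℝ) ≤ G741 + 1 := by linarith only [hG7410]
      have hWx : 0 ≤ W * x := by positivity
      nlinarith only [this, hWx]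
    linarith only [e1, hKc']
  have hWxG : 48600 * (W * x * G741) ≤ 1 := by
    have e1 : W * x * G741 ≤ W * x * (G741 + 1) :=
      mul_le_mul_of_nonneg_left (by linarith only) (by positivity)
    linarith only [e1, hKc']
  -- the levels
  obtain ⟨S₀, hS₀def⟩ : ∃ S : ℝ, S = 2 * ε ^ 2 * E * x := ⟨_, rfl⟩
  obtain ⟨S₁, hS₁def⟩ : ∃ S : ℝ, S = 9 * ε ^ 2 * E * x := ⟨_, rfl⟩
  have hS₀0 : 0 ≤ S₀ := by rw [hS₀def]; positivity
  -- the source on the past: `A_c + B_c ≤ S₀`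
  have hsrc : 12 * ε ^ 2 * E * A + 4 * C₁ * δ * Bx ≤ S₀ := by
    rw [hS₀def]
    have h1 : 12 * ε ^ 2 * E * A ≤ ε ^ 2 * E * x := by
      have := mul_le_mul_of_nonneg_left hKa (by positivity : (0 : ℝ) ≤ ε ^ 2 * E)
      linarith only [this]
    linarith only [h1, hδ1]
  have hS₀ : ∀ k, n₀ - N < k → k ≤ 0 → ∀ t ∈ Icc (τ (k - 1)) (τ k),
      ∫ s in (τ (n₀ - N))..t, ((1 + ε₀) ^ ((5 : ℝ) / 2) * ε ^ 2 * Real.exp (-K ^ 10) * Xr 0 1 s ^ 2 +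
        4 * C₁ * (1 + ε₀) ^ (-(n₀ : ℝ) / 2) * Real.sqrt (Er 1 s)) ≤
        S₀ * (1 + ε₀) ^ ((496 : ℝ) / 100 * k) := by
    intro k hk hk0 s hs
    have h1 := h.integral_source_one_past_le hε₀ hε₀1 hK hε hC₁ hC₃ hκ hk hk0 hs
    rw [← hBxdef, ← hEdef, ← hδdef, ← hAdef] at h1
    rw [← hEdef, ← hδdef]
    exact h1.trans (mul_le_mul_of_nonneg_right hsrc (Real.rpow_pos_of_pos h0 _).le)
  -- the source on the present: `≤ S₁`
  have hS₁ : ∀ t ∈ Icc 0 T,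
      ∫ s in (τ (n₀ - N))..t, ((1 + ε₀) ^ ((5 : ℝ) / 2) * ε ^ 2 * Real.exp (-K ^ 10) * Xr 0 1 s ^ 2 +
        4 * C₁ * (1 + ε₀) ^ (-(n₀ : ℝ) / 2) * Real.sqrt (Er 1 s)) ≤ S₁ := by
    intro s hs
    have h1 := h.integral_source_one_present_le hε₀ hε₀1 hK hε hC₁ hC₃ hN hκ hT hE1 hP hs
    rw [← hBxdef, ← hEdef, ← hδdef, ← hAdef] at h1
    rw [← hEdef, ← hδdef]
    rw [hS₀def] at hsrc
    rw [hS₁def]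
    linarith only [h1, hsrc, hδ2]
  -- the squared levels
  have hsq₀ : (Real.exp (6 / 100 * K ^ 10) * S₀) ^ 2 = 4 * ε ^ 4 * x ^ 2 * Real.exp (-(188 / 100) * K ^ 10) := by
    rw [hS₀def, hEdef, sq_level_eq K 2 ε x]; ring
  have hsq₁ : (Real.exp (6 / 100 * K ^ 10) * S₁) ^ 2 = 81 * ε ^ 4 * x ^ 2 * Real.exp (-(188 / 100) * K ^ 10) := by
    rw [hS₁def, hEdef, sq_level_eq K 9 ε x]; ring
  -- the `b₁`-level `B = 11 ε x`
  have hterm2 : 6 * ε⁻¹ * K ^ 10 * ((Real.exp (6 / 100 * K ^ 10) * S₀) ^ 2 * C₃ * geomConst ε₀ ((741 : ℝ) / 100)) ≤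
      ε * x := by
    rw [hsq₀]
    have hid : 6 * ε⁻¹ * K ^ 10 * (4 * ε ^ 4 * x ^ 2 * Real.exp (-(188 / 100) * K ^ 10) * C₃ *
        geomConst ε₀ ((741 : ℝ) / 100)) = ε * x * (24 * (ε ^ 2 * (W * x * G741))) := by
      rw [hWdef, hG741def]; field_simp; ring
    rw [hid]
    have e1 : ε ^ 2 * (W * x * G741) ≤ 1 * (W * x * G741) :=
      mul_le_mul_of_nonneg_right hε2 (by positivity)
    have e2 : 24 * (ε ^ 2 * (W * x * G741)) ≤ 1 := by linarith only [e1, hWxG]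
    calc ε * x * (24 * (ε ^ 2 * (W * x * G741))) ≤ ε * x * 1 := mul_le_mul_of_nonneg_left e2 hεx0
      _ = ε * x := mul_one _
  have hterm5 : 100 * (6 * ε⁻¹ * K ^ 10 * (Real.exp (6 / 100 * K ^ 10) * S₁) ^ 2) ≤ ε * x := by
    rw [hsq₁]
    have hid : 100 * (6 * ε⁻¹ * K ^ 10 * (81 * ε ^ 4 * x ^ 2 * Real.exp (-(188 / 100) * K ^ 10))) =
        ε * x * (ε ^ 2 * (48600 * (W * x))) := by
      rw [hWdef]; field_simp; ring
    rw [hid]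
    have e1 : ε ^ 2 * (48600 * (W * x)) ≤ 1 * (48600 * (W * x)) :=
      mul_le_mul_of_nonneg_right hε2 (by positivity)
    have e2 : ε ^ 2 * (48600 * (W * x)) ≤ 1 := by linarith only [e1, hWx1]
    calc ε * x * (ε ^ 2 * (48600 * (W * x))) ≤ ε * x * 1 := mul_le_mul_of_nonneg_left e2 hεx0
      _ = ε * x := mul_one _
  have hterm1 : 12 * ε * ((K ^ 30)⁻¹ * C₃ * geomConst ε₀ ((747 : ℝ) / 100)) ≤ ε * x := by
    rw [← hAdef]
    have := mul_le_mul_of_nonneg_left hKa hε.le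
    linarith only [this]
  have hterm3 : 4 * C₁ * δ * Bx ≤ ε * x := hδ1.trans hε2Ex
  have hterm6 : 100 * (4 * C₁ * δ) ≤ ε * x := by linarith only [hδ2, hε2Ex]
  have hB : (12 * ε * ((K ^ 30)⁻¹ * C₃ * geomConst ε₀ ((747 : ℝ) / 100)) +
        6 * ε⁻¹ * K ^ 10 * ((Real.exp (6 / 100 * K ^ 10) * S₀) ^ 2 * C₃ * geomConst ε₀ ((741 : ℝ) / 100)) +
        4 * C₁ * δ * Bx) +
      6 * ε * x + 100 * (6 * ε⁻¹ * K ^ 10 * (Real.exp (6 / 100 * K ^ 10) * S₁) ^ 2 + 4 * C₁ * δ) ≤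
      11 * ε * x := by
    have e : 100 * (6 * ε⁻¹ * K ^ 10 * (Real.exp (6 / 100 * K ^ 10) * S₁) ^ 2 + 4 * C₁ * δ) =
        100 * (6 * ε⁻¹ * K ^ 10 * (Real.exp (6 / 100 * K ^ 10) * S₁) ^ 2) + 100 * (4 * C₁ * δ) := by ring
    rw [e]
    linarith only [hterm1, hterm2, hterm3, hterm5, hterm6]
  -- the closing condition
  have hDb : 12 * ε * ((K ^ 30)⁻¹ * C₃ * geomConst ε₀ ((747 : ℝ) / 100)) +
        6 * ε⁻¹ * K ^ 10 * ((Real.exp (6 / 100 * K ^ 10) * S₀) ^ 2 * C₃ * geomConst ε₀ ((741 : ℝ) / 100)) +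
        4 * C₁ * δ * Bx ≤ 3 * (ε * x) := by linarith only [hterm1, hterm2, hterm3]
  have hclose : (12 * ε * ((K ^ 30)⁻¹ * C₃ * geomConst ε₀ ((747 : ℝ) / 100)) +
        6 * ε⁻¹ * K ^ 10 * ((Real.exp (6 / 100 * K ^ 10) * S₀) ^ 2 * C₃ * geomConst ε₀ ((741 : ℝ) / 100)) +
        4 * C₁ * δ * Bx) *
      C₃ * geomConst ε₀ ((245 : ℝ) / 100) + 100 * (11 * ε * x) < ε / 100 := by
    have h1 : (12 * ε * ((K ^ 30)⁻¹ * C₃ * geomConst ε₀ ((747 : ℝ) / 100)) +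
        6 * ε⁻¹ * K ^ 10 * ((Real.exp (6 / 100 * K ^ 10) * S₀) ^ 2 * C₃ * geomConst ε₀ ((741 : ℝ) / 100)) +
        4 * C₁ * δ * Bx) * C₃ * geomConst ε₀ ((245 : ℝ) / 100) ≤ 3 * (ε * x) * G245 := by
      rw [mul_assoc _ C₃, ← hG245def]
      exact mul_le_mul_of_nonneg_right hDb hG2450
    have h2 : ε * (x * (3 * G245 + 1100)) < ε * (1 / 100) := by
      rw [hG245def]
      refine mul_lt_mul_of_pos_left ?_ hε
      calc x * (3 * (C₃ * geomConst ε₀ (245 / 100)) + 1100) =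
          x * (3 * C₃ * geomConst ε₀ (245 / 100) + 1100) := by ring
        _ < 1 / 100 := hKd
    have h3 : 3 * (ε * x) * G245 + 100 * (11 * ε * x) = ε * (x * (3 * G245 + 1100)) := by ring
    linarith only [h1, h2, h3]
  -- apply Prop. 6.13 with these levels
  have hmain := h.prop613_bounds hε₀ hε₀1 hK hε hC₁ hC₃ hN hS₀0 hT0 hT hκ hS₀ hS₁ hE1 hE2 hP
    (B := 11 * ε * x) (by rw [← hδdef, ← hBxdef]; exact hB) (by rw [← hδdef, ← hBxdef]; exact hclose) ht
  rw [← hδdef, ← hBxdef] at hmain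
  obtain ⟨hb, hc, hcl, hd⟩ := hmain
  have hcM : Real.exp (6 / 100 * K ^ 10) * S₁ = 9 * x * Real.exp (-(94 / 100) * K ^ 10) * ε ^ 2 := by
    rw [hS₁def, hEdef, ← exp_six_mul_exp_neg]; ring
  refine ⟨by linarith only [hb], by rw [← hcM]; exact hc, hcl, ?_⟩
  rw [hcM] at hd
  exact hd

/-- **The forwards-exit exclusion for Cor. 6.14** ((6.92) ⟹ `|d₁| < ½K^{-10}`): under the hypotheses of
`prop613_regime` and the two further largeness conditions
`e^{3600√2K^{-14}} ≤ 2`, `100(54√2 K^{-1/4}e^{-(94/100)K^{10}} + 4C₁(1+ε₀)^{-n₀/2}) ≤ K^{-15}`, one has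
`|d₁(T)| < ½ K^{-10}` — the hypothesis `h13d` of `RescaledHypotheses.exists_second_bootstrap_time`
(`TaoCascadeSecondBootstrap.lean`), given `K ≥ 2`. [cite: Tao2016AveragedNS, §6.6 Prop. 6.13 (6.92), Cor. 6.14] -/
theorem RescaledHypotheses.prop613_d_one_lt
    (h : RescaledHypotheses γ ε₀ K ε C₁ C₂ C₃ n₀ N τ Xr Er) (hε₀ : 0 < ε₀) (hε₀1 : ε₀ < 1)
    (hK : 2 ≤ K) (hε : 0 < ε) (hε1 : ε ≤ 1) (hC₁ : 0 ≤ C₁) (hC₃ : 0 ≤ C₃) (hN : n₀ ≤ N)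
    (hκ : 36 * Real.sqrt 2 * K * ((K ^ 15)⁻¹ * (1 + ε₀) ^ (-(999 : ℝ) / 100) * C₃ *
      geomConst ε₀ ((248 : ℝ) / 100)) ≤ 1)
    (hKa : 12 * ((K ^ 30)⁻¹ * C₃ * geomConst ε₀ ((747 : ℝ) / 100)) ≤ K ^ (-(1 : ℝ) / 4))
    (hKc : 48600 * K ^ 10 * Real.exp (-(188 / 100) * K ^ 10) * K ^ (-(1 : ℝ) / 4) *
      (C₃ * geomConst ε₀ ((741 : ℝ) / 100) + 1) ≤ 1)
    (hKd : K ^ (-(1 : ℝ) / 4) * (3 * C₃ * geomConst ε₀ ((245 : ℝ) / 100) + 1100) < 1 / 100)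
    (hδ1 : 4 * C₁ * (1 + ε₀) ^ (-(n₀ : ℝ) / 2) *
      (Real.exp 1 * (6 * Real.sqrt 2 * K) * cumEnergyConst ε₀ C₃ * C₃ * geomConst ε₀ ((496 : ℝ) / 100)) ≤
      ε ^ 2 * Real.exp (-K ^ 10) * K ^ (-(1 : ℝ) / 4))
    (hδ2 : 400 * C₁ * (1 + ε₀) ^ (-(n₀ : ℝ) / 2) ≤ ε ^ 2 * Real.exp (-K ^ 10) * K ^ (-(1 : ℝ) / 4))
    (hKe : Real.exp (3600 * Real.sqrt 2 * (K ^ 14)⁻¹) ≤ 2)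
    (hKf : 100 * (54 * Real.sqrt 2 * K ^ (-(1 : ℝ) / 4) * Real.exp (-(94 / 100) * K ^ 10) +
      4 * C₁ * (1 + ε₀) ^ (-(n₀ : ℝ) / 2)) ≤ (K ^ 15)⁻¹)
    {T : ℝ} (hT0 : 0 ≤ T) (hT : T ≤ 100) (hE1 : ∀ t ∈ Icc 0 T, Er 1 t ≤ 1)
    (hE2 : ∀ t ∈ Icc 0 T, Er 2 t ≤ (K ^ 30)⁻¹)
    (hP : ∫ s in (0 : ℝ)..T, Xr 0 1 s ^ 2 ≤ K ^ (-(1 : ℝ) / 4)) {t : ℝ} (ht : t ∈ Icc 0 T) :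
    |Xr 3 1 t| < 1 / 2 * (K ^ 10)⁻¹ := by
  have hKpos : 0 < K := by linarith
  obtain ⟨-, -, -, hd⟩ := h.prop613_regime hε₀ hε₀1 (by linarith) hε hε1 hC₁ hC₃ hN hκ hKa hKc hKd
    hδ1 hδ2 hT0 hT hE1 hE2 hP ht
  have hsimp : 6 * Real.sqrt 2 * (ε ^ 2)⁻¹ *
      (9 * K ^ (-(1 : ℝ) / 4) * Real.exp (-(94 / 100) * K ^ 10) * ε ^ 2) =
      54 * Real.sqrt 2 * K ^ (-(1 : ℝ) / 4) * Real.exp (-(94 / 100) * K ^ 10) := by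
    field_simp; ring
  rw [hsimp] at hd
  -- `|d₁| ≤ (√2 K^{-15} + K^{-15}) · 2 ≤ 5 K^{-15} < ½ K^{-10}`
  have hK15 : 0 < (K ^ 15)⁻¹ := by positivity
  have hs2 : Real.sqrt 2 ≤ 3 / 2 := by
    rw [show (3 : ℝ) / 2 = Real.sqrt ((3 / 2) ^ 2) by rw [Real.sqrt_sq]; norm_num]
    exact Real.sqrt_le_sqrt (by norm_num)
  have h1 : |Xr 3 1 t| ≤ 5 * (K ^ 15)⁻¹ := by
    refine hd.trans ?_
    have hsum : Real.sqrt 2 * (K ^ 15)⁻¹ +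
        100 * (54 * Real.sqrt 2 * K ^ (-(1 : ℝ) / 4) * Real.exp (-(94 / 100) * K ^ 10) +
          4 * C₁ * (1 + ε₀) ^ (-(n₀ : ℝ) / 2)) ≤ (5 / 2) * (K ^ 15)⁻¹ := by nlinarith
    have hpos : 0 ≤ Real.sqrt 2 * (K ^ 15)⁻¹ +
        100 * (54 * Real.sqrt 2 * K ^ (-(1 : ℝ) / 4) * Real.exp (-(94 / 100) * K ^ 10) +
          4 * C₁ * (1 + ε₀) ^ (-(n₀ : ℝ) / 2)) := by
      have : 0 < (1 : ℝ) + ε₀ := by linarith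
      positivity
    calc _ ≤ (5 / 2) * (K ^ 15)⁻¹ * 2 := mul_le_mul hsum hKe (Real.exp_pos _).le (by positivity)
      _ = 5 * (K ^ 15)⁻¹ := by ring
  -- `5 K^{-15} < ½ K^{-10}` for `K ≥ 2`
  have h2 : 5 * (K ^ 15)⁻¹ < 1 / 2 * (K ^ 10)⁻¹ := by
    rw [show (K ^ 15)⁻¹ = (K ^ 10)⁻¹ * (K ^ 5)⁻¹ by rw [← mul_inv, ← pow_add]]
    have hK5 : (32 : ℝ) ≤ K ^ 5 := by nlinarith [pow_le_pow_left₀ (by norm_num : (0:ℝ) ≤ 2) hK 5]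
    have hK5inv : (K ^ 5)⁻¹ ≤ 1 / 32 := by
      rw [inv_eq_one_div, div_le_div_iff₀ (by positivity) (by norm_num)]; linarith
    have hK10 : 0 < (K ^ 10)⁻¹ := by positivity
    nlinarith
  exact h1.trans_lt h2

/-- **Prop. 6.13 as the regime bounds `SmallModes K ε 11`** of `TaoCascadeZeroScaleSetup.lean`
((6.116)–(6.117) with `C₄ = 11`; the `c₁`-bound uses `9K^{-1/4}e^{-(94/100)K^{10}} ≤ 11 e^{-K^{10}/2}`).
[cite: Tao2016AveragedNS, §6.6 Prop. 6.13 (6.116)–(6.117)] -/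
theorem RescaledHypotheses.prop613_smallModes
    (h : RescaledHypotheses γ ε₀ K ε C₁ C₂ C₃ n₀ N τ Xr Er) (hε₀ : 0 < ε₀) (hε₀1 : ε₀ < 1)
    (hK : 1 ≤ K) (hε : 0 < ε) (hε1 : ε ≤ 1) (hC₁ : 0 ≤ C₁) (hC₃ : 0 ≤ C₃) (hN : n₀ ≤ N)
    (hκ : 36 * Real.sqrt 2 * K * ((K ^ 15)⁻¹ * (1 + ε₀) ^ (-(999 : ℝ) / 100) * C₃ *
      geomConst ε₀ ((248 : ℝ) / 100)) ≤ 1)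
    (hKa : 12 * ((K ^ 30)⁻¹ * C₃ * geomConst ε₀ ((747 : ℝ) / 100)) ≤ K ^ (-(1 : ℝ) / 4))
    (hKc : 48600 * K ^ 10 * Real.exp (-(188 / 100) * K ^ 10) * K ^ (-(1 : ℝ) / 4) *
      (C₃ * geomConst ε₀ ((741 : ℝ) / 100) + 1) ≤ 1)
    (hKd : K ^ (-(1 : ℝ) / 4) * (3 * C₃ * geomConst ε₀ ((245 : ℝ) / 100) + 1100) < 1 / 100)
    (hδ1 : 4 * C₁ * (1 + ε₀) ^ (-(n₀ : ℝ) / 2) *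
      (Real.exp 1 * (6 * Real.sqrt 2 * K) * cumEnergyConst ε₀ C₃ * C₃ * geomConst ε₀ ((496 : ℝ) / 100)) ≤
      ε ^ 2 * Real.exp (-K ^ 10) * K ^ (-(1 : ℝ) / 4))
    (hδ2 : 400 * C₁ * (1 + ε₀) ^ (-(n₀ : ℝ) / 2) ≤ ε ^ 2 * Real.exp (-K ^ 10) * K ^ (-(1 : ℝ) / 4))
    {T : ℝ} (hT0 : 0 ≤ T) (hT : T ≤ 100) (hE1 : ∀ t ∈ Icc 0 T, Er 1 t ≤ 1)
    (hE2 : ∀ t ∈ Icc 0 T, Er 2 t ≤ (K ^ 30)⁻¹)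
    (hP : ∫ s in (0 : ℝ)..T, Xr 0 1 s ^ 2 ≤ K ^ (-(1 : ℝ) / 4)) :
    ZeroScale.SmallModes K ε 11 Xr T := by
  have hKpos : 0 < K := by linarith
  constructor
  · intro t ht
    obtain ⟨hb, -, -, -⟩ := h.prop613_regime hε₀ hε₀1 hK hε hε1 hC₁ hC₃ hN hκ hKa hKc hKd hδ1 hδ2
      hT0 hT hE1 hE2 hP ht
    linarith
  · intro t ht
    obtain ⟨-, hc, -, -⟩ := h.prop613_regime hε₀ hε₀1 hK hε hε1 hC₁ hC₃ hN hκ hKa hKc hKd hδ1 hδ2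
      hT0 hT hE1 hE2 hP ht
    refine hc.trans ?_
    have hx1 : K ^ (-(1 : ℝ) / 4) ≤ 1 := Real.rpow_le_one_of_one_le_of_nonpos hK (by norm_num)
    have hx0 : 0 ≤ K ^ (-(1 : ℝ) / 4) := (Real.rpow_pos_of_pos hKpos _).le
    have hK10 : 0 ≤ K ^ 10 := by positivity
    have hexp : Real.exp (-(94 / 100) * K ^ 10) ≤ Real.exp (-K ^ 10 / 2) := by
      apply Real.exp_le_exp.2
      linarith only [hK10]
    have hε2 : 0 ≤ ε ^ 2 := sq_nonneg _
    calc 9 * K ^ (-(1 : ℝ) / 4) * Real.exp (-(94 / 100) * K ^ 10) * ε ^ 2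
        ≤ 9 * 1 * Real.exp (-K ^ 10 / 2) * ε ^ 2 := by
          gcongr
      _ ≤ 11 * Real.exp (-K ^ 10 / 2) * ε ^ 2 := by
          have := Real.exp_pos (-K ^ 10 / 2); nlinarith
      _ = _ := by ring

end Regime

end TaoCascade

end Literature.Analysis.FluidPDE
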